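import Summits.KontsevichZagierPeriods.Zeta5Search.Certificates.VIMLevel2NKKey
import Summits.KontsevichZagierPeriods.Zeta5Search.Certificates.VIMLevel2K2All
import HarnessLib

/-!
# ζ(5) search — brown9 LEVEL 2 (R-NK): the termwise telescoping identity (cell `pub-zeta5`, certifier `cert-1`)

HONEST FRAMING: systematic search; no irrationality claim unless certified.

With `s(n,x,k) = h·T(n; p, q)` (`p = 3n−x−k`, `q = 2n−k`, `h = (−1)^k C(n,k) C(p,n)`; `Certificates/VIMLevel2K2.lean`)
and the R-NK certificate `g(k) = h·k·(PR0·T(n;p,q) + PR1·T(n;p+1,q))/den0`,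
`den0 = p (p+2−n)² (p+1−n) (n+1−k)²` (ttrl2 `r1c/R_NK.json`, data ×5 in `Certificates/VIMLevel2NKData.lean`),
this file proves the TERMWISE identity
  `e10·s(n+1,x,k) + e00·s(n,x,k) + e01·s(n,x+1,k) = g(k+1) − g(k)`   (`n = m+3 ≥ 3`, `k ≤ n−1`, `x < 0`)
from `NK_key` (`Certificates/VIMLevel2NKKey.lean`: the level-1 reduction plus the two kernel-checked coordinate
identities) and four unit expansions of `h` at `(n+1,x,k), (n,x,k), (n,x+1,k), (n,x,k+1)` in the common unit
`u = (−1)^k C(n+1,k)·fallProd (n−3) (p−1)`. The restriction `x < 0` keeps every cancelled leading coefficient nonzero;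
the relation for all `x` follows later by polynomiality. No named facts.
-/

noncomputable section

namespace Summit.KontsevichZagierPeriods.Zeta5Search.Certificates

namespace VIMInner

open Finset PolyReflect
open Summit.KontsevichZagierPeriods.Zeta5Search.SymmetricRecursion (choose_succ_left_cast choose_succ_right_cast)

/-! ### Shifts and falling products -/

/-- `p(n+1,x,k) = p(n,x,k) + 3`. -/
theorem pOf_nsucc (n : ℕ) (x : ℚ) (k : ℕ) : pOf (n + 1) x k = pOf n x k + 3 := by unfold pOf; push_cast; ring
/-- `q(n+1,k) = q(n,k) + 2`. -/
theorem qOf_nsucc (n : ℕ) (k : ℕ) : qOf (n + 1) k = qOf n k + 2 := by unfold qOf; push_cast; ring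

/-- `fallProd (m+3) y = fallProd m y · (y−m)(y−m−1)(y−m−2)`. -/
theorem fallProd_three (m : ℕ) (y : ℚ) :
    fallProd (m + 3) y = fallProd m y * ((y - m) * (y - m - 1) * (y - m - 2)) := by
  rw [show m + 3 = m + 2 + 1 from rfl, fallProd_succ, fallProd_two]; push_cast; ring

/-- `fallProd (m+3) y = y · fallProd m (y−1) · (y−1−m)(y−2−m)`. -/
theorem fallProd_three_pred (m : ℕ) (y : ℚ) :
    fallProd (m + 3) y = y * fallProd m (y - 1) * ((y - 1 - m) * (y - 2 - m)) := by
  rw [show m + 3 = m + 2 + 1 from rfl, fallProd_succ_pred, fallProd_two]; ring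

/-- `fallProd (m+4) (y+3) = (y+3)(y+2)(y+1)y · fallProd m (y−1)`. -/
theorem fallProd_four_pred (m : ℕ) (y : ℚ) :
    fallProd (m + 4) (y + 3) = (y + 3) * (y + 2) * (y + 1) * y * fallProd m (y - 1) := by
  rw [show m + 4 = m + 1 + 1 + 1 + 1 from rfl, fallProd_succ_pred, fallProd_succ_pred, fallProd_succ_pred,
    fallProd_succ_pred, show y + 3 - 1 = y + 2 by ring, show y + 2 - 1 = y + 1 by ring, show y + 1 - 1 = y by ring]
  ring

namespace NK

/-! ### The certificate -/

/-- `den0(n,x,k) = p (p+2−n)² (p+1−n) (n+1−k)²` (the lane's `dden/(k₅+1)`). -/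
def den0 (n : ℕ) (x : ℚ) (k : ℕ) : ℚ :=
  pOf n x k * (pOf n x k + 2 - n) ^ 2 * (pOf n x k + 1 - n) * ((n : ℚ) + 1 - k) ^ 2

/-- The R-NK certificate `g(k) = h·k·(PR0·T(n;p,q) + PR1·T(n;p+1,q))/den0` (×5, as all data here). -/
def gNK (n : ℕ) (x : ℚ) (k : ℕ) : ℚ :=
  hR n x k * (k : ℚ) * (PR0 n x k * T n (pOf n x k) (qOf n k) + PR1 n x k * T n (pOf n x k + 1) (qOf n k)) / den0 n x k

/-- `g(0) = 0`. -/
theorem gNK_zero (n : ℕ) (x : ℚ) : gNK n x 0 = 0 := by simp [gNK]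

/-! ### Unit expansions at `n = m+3` -/

/-- The unit `u = (−1)^k C(m+4,k) · fallProd m (p−1)`, `p = p(m+3,x,k)`. -/
def uN (m : ℕ) (x : ℚ) (k : ℕ) : ℚ := (-1) ^ k * (((m + 4).choose k : ℕ) : ℚ) * fallProd m (pOf (m + 3) x k - 1)

/-- `F = (m+4)!`. -/
def FN (m : ℕ) : ℚ := ((m + 4).factorial : ℚ)

/-- `F ≠ 0`. -/
theorem FN_ne_zero (m : ℕ) : FN m ≠ 0 := by unfold FN; positivity

/-- `F·h(m+4,x,k) = u·(p+3)(p+2)(p+1)p`. -/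
theorem hN1 (m : ℕ) (x : ℚ) (k : ℕ) :
    FN m * hR (m + 3 + 1) x k
      = uN m x k * ((pOf (m + 3) x k + 3) * (pOf (m + 3) x k + 2) * (pOf (m + 3) x k + 1) * pOf (m + 3) x k) := by
  unfold FN hR uN bp
  rw [show m + 3 + 1 = m + 4 from rfl, pOf_nsucc, fallProd_four_pred]
  field_simp

/-- `C(m+3,k) = C(m+4,k)·(m+4−k)/(m+4)` in `ℚ`. -/
theorem choose_m3 (m k : ℕ) :
    (((m + 3).choose k : ℕ) : ℚ) = (((m + 4).choose k : ℕ) : ℚ) * (((m : ℚ) + 4) - k) / ((m : ℚ) + 4) := by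
  have h := choose_succ_left_cast (m + 3) k
  rw [show m + 3 + 1 = m + 4 from rfl] at h
  push_cast at h
  have hm : ((m : ℚ) + 4) ≠ 0 := by positivity
  rw [eq_div_iff hm]
  linear_combination (-1 : ℚ) * h

/-- `C(m+3,k+1) = C(m+3,k)·(m+3−k)/(k+1)` in `ℚ`. -/
theorem choose_m3_succ (m k : ℕ) :
    (((m + 3).choose (k + 1) : ℕ) : ℚ) = (((m + 3).choose k : ℕ) : ℚ) * (((m : ℚ) + 3) - k) / ((k : ℚ) + 1) := by
  have h := choose_succ_right_cast (m + 3) k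
  push_cast at h
  have hk : ((k : ℚ) + 1) ≠ 0 := by positivity
  rw [eq_div_iff hk]
  linear_combination h

/-- `F·h(m+3,x,k) = u·(m+4−k)·p(p−m−1)(p−m−2)`. -/
theorem hN0 (m : ℕ) (x : ℚ) (k : ℕ) :
    FN m * hR (m + 3) x k
      = uN m x k * ((((m : ℚ) + 4) - k) * pOf (m + 3) x k * (pOf (m + 3) x k - m - 1) * (pOf (m + 3) x k - m - 2)) := by
  unfold FN hR uN bp
  rw [choose_m3, fallProd_three_pred, show m + 4 = m + 3 + 1 from rfl, Nat.factorial_succ (m + 3)]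
  push_cast
  have hf : (((m + 3).factorial : ℕ) : ℚ) ≠ 0 := by positivity
  have hm : ((m : ℚ) + 4) ≠ 0 := by positivity
  have hm' : ((m : ℚ) + 3 + 1) ≠ 0 := by positivity
  field_simp
  ring

/-- `F·h(m+3,x+1,k) = u·(m+4−k)(p−m−1)(p−m−2)(p−m−3)`. -/
theorem hN01 (m : ℕ) (x : ℚ) (k : ℕ) :
    FN m * hR (m + 3) (x + 1) k
      = uN m x k * ((((m : ℚ) + 4) - k) * (pOf (m + 3) x k - m - 1) * (pOf (m + 3) x k - m - 2) * (pOf (m + 3) x k - m - 3)) := by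
  unfold FN hR uN bp
  rw [choose_m3, pOf_xsucc, fallProd_three, show m + 4 = m + 3 + 1 from rfl, Nat.factorial_succ (m + 3)]
  push_cast
  have hf : (((m + 3).factorial : ℕ) : ℚ) ≠ 0 := by positivity
  have hm : ((m : ℚ) + 4) ≠ 0 := by positivity
  have hm' : ((m : ℚ) + 3 + 1) ≠ 0 := by positivity
  field_simp
  ring

/-- `F·(k+1)·h(m+3,x,k+1) = −u·(m+4−k)(m+3−k)(p−m−1)(p−m−2)(p−m−3)`. -/
theorem hNk (m : ℕ) (x : ℚ) (k : ℕ) :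
    FN m * ((k : ℚ) + 1) * hR (m + 3) x (k + 1)
      = -(uN m x k * ((((m : ℚ) + 4) - k) * (((m : ℚ) + 3) - k) * (pOf (m + 3) x k - m - 1) * (pOf (m + 3) x k - m - 2)
          * (pOf (m + 3) x k - m - 3))) := by
  unfold FN hR uN bp
  rw [choose_m3_succ, choose_m3, pOf_ksucc, fallProd_three, show m + 4 = m + 3 + 1 from rfl, Nat.factorial_succ (m + 3)]
  push_cast
  have hf : (((m + 3).factorial : ℕ) : ℚ) ≠ 0 := by positivity
  have hm : ((m : ℚ) + 4) ≠ 0 := by positivity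
  have hm' : ((m : ℚ) + 3 + 1) ≠ 0 := by positivity
  have hk : ((k : ℚ) + 1) ≠ 0 := by positivity
  field_simp
  ring

/-! ### The KEYPOLY coefficients in ordinary form -/

/-- The KEYPOLY coefficient `eK_U` in ordinary form. -/
theorem bK_U (n : ℕ) (x k : ℚ) : peval eK_U [(n : ℚ), x, k] = -(-k + (n : ℚ))*(-k + (n : ℚ) + 1)*(k - 3*(n : ℚ) + x)*(k - 3*(n : ℚ) + x - 3)*(k - 3*(n : ℚ) + x - 2)*(k - 3*(n : ℚ) + x - 1)*(k - 3*(n : ℚ) + x + 1)*(k - 2*(n : ℚ) + x - 2)*(k - 2*(n : ℚ) + x - 1) := by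
  have d0 : pvar [(n : ℚ), x, k] 0 = (n : ℚ) := rfl
  have d1 : pvar [(n : ℚ), x, k] 1 = x := rfl
  have d2 : pvar [(n : ℚ), x, k] 2 = k := rfl
  simp only [eK_U, peval_mul, peval_add, peval_neg, peval_num, peval_var, d0, d1, d2]
  push_cast
  ring

/-- The KEYPOLY coefficient `eK_T00e` in ordinary form. -/
theorem bK_T00e (n : ℕ) (x k : ℚ) : peval eK_T00e [(n : ℚ), x, k] = (-k + (n : ℚ))*(-k + (n : ℚ) + 1)^2*(k - 3*(n : ℚ) + x)*(k - 3*(n : ℚ) + x + 1)*(k - 2*(n : ℚ) + x - 2)^2*(k - 2*(n : ℚ) + x - 1)^2 := by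
  have d0 : pvar [(n : ℚ), x, k] 0 = (n : ℚ) := rfl
  have d1 : pvar [(n : ℚ), x, k] 1 = x := rfl
  have d2 : pvar [(n : ℚ), x, k] 2 = k := rfl
  simp only [eK_T00e, peval_mul, peval_add, peval_neg, peval_num, peval_var, d0, d1, d2]
  push_cast
  ring

/-- The KEYPOLY coefficient `eK_Tm1` in ordinary form. -/
theorem bK_Tm1 (n : ℕ) (x k : ℚ) : peval eK_Tm1 [(n : ℚ), x, k] = (-k + (n : ℚ))*(-k + (n : ℚ) + 1)^2*(k - 2*(n : ℚ) + x)*(k - 3*(n : ℚ) + x + 1)*(k - 2*(n : ℚ) + x - 2)^2*(k - 2*(n : ℚ) + x - 1)^2 := by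
  have d0 : pvar [(n : ℚ), x, k] 0 = (n : ℚ) := rfl
  have d1 : pvar [(n : ℚ), x, k] 1 = x := rfl
  have d2 : pvar [(n : ℚ), x, k] 2 = k := rfl
  simp only [eK_Tm1, peval_mul, peval_add, peval_neg, peval_num, peval_var, d0, d1, d2]
  push_cast
  ring

/-- The KEYPOLY coefficient `eK_Tmm` in ordinary form. -/
theorem bK_Tmm (n : ℕ) (x k : ℚ) : peval eK_Tmm [(n : ℚ), x, k] = (-k + (n : ℚ) + 1)^2*(k - 2*(n : ℚ) + x - 2)^2 := by
  have d0 : pvar [(n : ℚ), x, k] 0 = (n : ℚ) := rfl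
  have d1 : pvar [(n : ℚ), x, k] 1 = x := rfl
  have d2 : pvar [(n : ℚ), x, k] 2 = k := rfl
  simp only [eK_Tmm, peval_mul, peval_add, peval_neg, peval_num, peval_var, d0, d1, d2]
  push_cast
  ring

/-- The KEYPOLY coefficient `eK_Tzm` in ordinary form. -/
theorem bK_Tzm (n : ℕ) (x k : ℚ) : peval eK_Tzm [(n : ℚ), x, k] = (-k + (n : ℚ) + 1)^2*(k - 2*(n : ℚ) + x - 2)^2 := by
  have d0 : pvar [(n : ℚ), x, k] 0 = (n : ℚ) := rfl
  have d1 : pvar [(n : ℚ), x, k] 1 = x := rfl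
  have d2 : pvar [(n : ℚ), x, k] 2 = k := rfl
  simp only [eK_Tzm, peval_mul, peval_add, peval_neg, peval_num, peval_var, d0, d1, d2]
  push_cast
  ring

/-- The KEYPOLY coefficient `eK_S0t` in ordinary form. -/
theorem bK_S0t (n : ℕ) (x k : ℚ) : peval eK_S0t [(n : ℚ), x, k] = k*(-k + (n : ℚ))*(k - 3*(n : ℚ) + x + 1)*(k - 2*(n : ℚ) + x - 1) := by
  have d0 : pvar [(n : ℚ), x, k] 0 = (n : ℚ) := rfl
  have d1 : pvar [(n : ℚ), x, k] 1 = x := rfl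
  have d2 : pvar [(n : ℚ), x, k] 2 = k := rfl
  simp only [eK_S0t, peval_mul, peval_add, peval_neg, peval_num, peval_var, d0, d1, d2]
  push_cast
  ring

/-- The KEYPOLY coefficient `eK_S1t` in ordinary form. -/
theorem bK_S1t (n : ℕ) (x k : ℚ) : peval eK_S1t [(n : ℚ), x, k] = k*(-k + (n : ℚ))*(k - 3*(n : ℚ) + x + 1)*(k - 2*(n : ℚ) + x - 1) := by
  have d0 : pvar [(n : ℚ), x, k] 0 = (n : ℚ) := rfl
  have d1 : pvar [(n : ℚ), x, k] 1 = x := rfl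
  have d2 : pvar [(n : ℚ), x, k] 2 = k := rfl
  simp only [eK_S1t, peval_mul, peval_add, peval_neg, peval_num, peval_var, d0, d1, d2]
  push_cast
  ring

/-! ### The termwise identity -/

set_option maxHeartbeats 4000000 in
/-- **(R-NK) termwise** at `n = m+3`: for `k ≤ n−1` and `x < 0`,
`e10·s(n+1,x,k) + e00·s(n,x,k) + e01·s(n,x+1,k) = g(k+1) − g(k)`. -/
theorem NK_termwise (m : ℕ) (x : ℚ) (k : ℕ) (hx : x < 0) (hk : k ≤ m + 2) :
    e10 ((m + 3 : ℕ) : ℚ) x * sR (m + 3 + 1) x k + e00 ((m + 3 : ℕ) : ℚ) x * sR (m + 3) x k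
        + e01 ((m + 3 : ℕ) : ℚ) x * sR (m + 3) (x + 1) k
      = gNK (m + 3) x (k + 1) - gNK (m + 3) x k := by
  have hkq : (k : ℚ) ≤ (m : ℚ) + 2 := by exact_mod_cast hk
  have hk0 : (0 : ℚ) ≤ k := Nat.cast_nonneg k
  have hm0 : (0 : ℚ) ≤ m := Nat.cast_nonneg m
  have hPdef : pOf (m + 3) x k = 3 * ((m : ℚ) + 3) - x - k := by unfold pOf; push_cast; ring
  -- nonvanishing linear forms on the region
  have nP : pOf (m + 3) x k ≠ 0 := by rw [hPdef]; exact ne_of_gt (by linarith)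
  have nP1 : pOf (m + 3) x k - 1 ≠ 0 := by rw [hPdef]; exact ne_of_gt (by linarith)
  have nPw : pOf (m + 3) x k - m - 3 ≠ 0 := by rw [hPdef]; exact ne_of_gt (by linarith)
  have nPw1 : pOf (m + 3) x k - m - 2 ≠ 0 := by rw [hPdef]; exact ne_of_gt (by linarith)
  have nPw2 : pOf (m + 3) x k - m - 1 ≠ 0 := by rw [hPdef]; exact ne_of_gt (by linarith)
  have nk1 : ((m : ℚ) + 4) - k ≠ 0 := ne_of_gt (by linarith)
  have nk0 : ((m : ℚ) + 3) - k ≠ 0 := ne_of_gt (by linarith)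
  have hF := FN_ne_zero m
  -- unit expansions and the certificate values
  have h1 := hN1 m x k
  have h0 := hN0 m x k
  have h01 := hN01 m x k
  have hk1 := hNk m x k
  have h0' : hR (m + 3) x k = uN m x k * ((((m : ℚ) + 4) - k) * pOf (m + 3) x k * (pOf (m + 3) x k - m - 1)
      * (pOf (m + 3) x k - m - 2)) / FN m := by
    rw [eq_div_iff hF]; linear_combination h0
  have hk1' : hR (m + 3) x (k + 1) = -(uN m x k * ((((m : ℚ) + 4) - k) * (((m : ℚ) + 3) - k) * (pOf (m + 3) x k - m - 1)
      * (pOf (m + 3) x k - m - 2) * (pOf (m + 3) x k - m - 3))) / (FN m * ((k : ℚ) + 1)) := by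
    have hk1q : ((k : ℚ) + 1) ≠ 0 := by positivity
    rw [eq_div_iff (mul_ne_zero hF hk1q)]; linear_combination hk1
  have dg0 : FN m * ((pOf (m + 3) x k - m - 1) * (((m : ℚ) + 4) - k) * (pOf (m + 3) x k - 1) * (pOf (m + 3) x k - m - 2)
        * (((m : ℚ) + 3) - k)) * gNK (m + 3) x k
      = uN m x k * ((k : ℚ) * ((pOf (m + 3) x k - 1) * (pOf (m + 3) x k - m - 2) * (((m : ℚ) + 3) - k)))
        * (PR0 ((m + 3 : ℕ) : ℚ) x k * T (m + 3) (pOf (m + 3) x k) (qOf (m + 3) k)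
            + PR1 ((m + 3 : ℕ) : ℚ) x k * T (m + 3) (pOf (m + 3) x k + 1) (qOf (m + 3) k)) := by
    have hden : den0 (m + 3) x k = pOf (m + 3) x k * (pOf (m + 3) x k - m - 1) ^ 2 * (pOf (m + 3) x k - m - 2)
        * (((m : ℚ) + 4) - k) ^ 2 := by unfold den0; push_cast; ring
    unfold gNK
    rw [hden, h0']
    field_simp
  have dg1 : FN m * ((pOf (m + 3) x k - m - 1) * (((m : ℚ) + 4) - k) * (pOf (m + 3) x k - 1) * (pOf (m + 3) x k - m - 2)
        * (((m : ℚ) + 3) - k)) * gNK (m + 3) x (k + 1)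
      = -(uN m x k * ((((m : ℚ) + 4) - k) ^ 2 * (pOf (m + 3) x k - m - 1) ^ 2))
        * (PR0 ((m + 3 : ℕ) : ℚ) x ((k : ℚ) + 1) * T (m + 3) (pOf (m + 3) x k - 1) (qOf (m + 3) k - 1)
            + PR1 ((m + 3 : ℕ) : ℚ) x ((k : ℚ) + 1) * T (m + 3) (pOf (m + 3) x k) (qOf (m + 3) k - 1)) := by
    have hden : den0 (m + 3) x (k + 1) = (pOf (m + 3) x k - 1) * (pOf (m + 3) x k - m - 2) ^ 2 * (pOf (m + 3) x k - m - 3)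
        * (((m : ℚ) + 3) - k) ^ 2 := by unfold den0; rw [pOf_ksucc]; push_cast; ring
    unfold gNK
    rw [hden, hk1', pOf_ksucc, qOf_ksucc, show pOf (m + 3) x k - 1 + 1 = pOf (m + 3) x k by ring]
    push_cast
    have hk1q : ((k : ℚ) + 1) ≠ 0 := by positivity
    field_simp
  -- the key identity from the level-1 reduction and the two kernel-checked coordinate identities
  have key := NK_key (m + 3) (by omega) x (k : ℚ) hx hk0 (by push_cast; linarith)
    (e10 ((m + 3 : ℕ) : ℚ) x) (e00 ((m + 3 : ℕ) : ℚ) x) (e01 ((m + 3 : ℕ) : ℚ) x)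
    (PR0 ((m + 3 : ℕ) : ℚ) x k) (PR1 ((m + 3 : ℕ) : ℚ) x k) (PR0 ((m + 3 : ℕ) : ℚ) x ((k : ℚ) + 1))
    (PR1 ((m + 3 : ℕ) : ℚ) x ((k : ℚ) + 1)) (fin0 _ x _) (fin1 _ x _)
  rw [bK_U, bK_T00e, bK_Tm1, bK_Tmm, bK_Tzm, bK_S0t, bK_S1t] at key
  -- canonical forms of all atoms: arguments of `T` as polynomials in `↑m, x, ↑k`
  unfold sR
  rw [pOf_nsucc, qOf_nsucc, pOf_xsucc]
  have hQdef : qOf (m + 3) k = 2 * ((m : ℚ) + 3) - k := by unfold qOf; push_cast; ring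
  rw [hPdef, hQdef] at dg0 dg1 ⊢
  rw [hPdef] at h1 h0 h01 hk1
  push_cast at h1 h0 h01 hk1 dg0 dg1 key ⊢
  have hW : FN m * ((3 * ((m : ℚ) + 3) - x - k - m - 1) * (((m : ℚ) + 4) - k) * (3 * ((m : ℚ) + 3) - x - k - 1)
      * (3 * ((m : ℚ) + 3) - x - k - m - 2) * (((m : ℚ) + 3) - k)) ≠ 0 := by
    refine mul_ne_zero hF ?_
    rw [hPdef] at nP1 nPw1 nPw2
    exact mul_ne_zero (mul_ne_zero (mul_ne_zero (mul_ne_zero nPw2 nk1) nP1) nPw1) nk0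
  apply mul_left_cancel₀ hW
  linear_combination
    ((3 * ((m : ℚ) + 3) - x - k - m - 1) * (((m : ℚ) + 4) - k) * (3 * ((m : ℚ) + 3) - x - k - 1)
        * (3 * ((m : ℚ) + 3) - x - k - m - 2) * (((m : ℚ) + 3) - k) * e10 ((m : ℚ) + 3) x
        * T (m + 3 + 1) (3 * ((m : ℚ) + 3) - x - k + 3) (2 * ((m : ℚ) + 3) - k + 2)) * h1
    + ((3 * ((m : ℚ) + 3) - x - k - m - 1) * (((m : ℚ) + 4) - k) * (3 * ((m : ℚ) + 3) - x - k - 1)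
        * (3 * ((m : ℚ) + 3) - x - k - m - 2) * (((m : ℚ) + 3) - k) * e00 ((m : ℚ) + 3) x
        * T (m + 3) (3 * ((m : ℚ) + 3) - x - k) (2 * ((m : ℚ) + 3) - k)) * h0
    + ((3 * ((m : ℚ) + 3) - x - k - m - 1) * (((m : ℚ) + 4) - k) * (3 * ((m : ℚ) + 3) - x - k - 1)
        * (3 * ((m : ℚ) + 3) - x - k - m - 2) * (((m : ℚ) + 3) - k) * e01 ((m : ℚ) + 3) x
        * T (m + 3) (3 * ((m : ℚ) + 3) - x - k - 1) (2 * ((m : ℚ) + 3) - k)) * h01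
    - dg1 + dg0 + uN m x k * key

end NK

end VIMInner

end Summit.KontsevichZagierPeriods.Zeta5Search.Certificates
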